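import Summits.CriticalPhenomena.PercolationContinuityZ3.Theorems.Transplant.FKConnectivityAllQAntipodalTwoSpineDefs
import HarnessLib

/-!
# Connectivity correlation inequalities for `φ_{w,q}` — TWO-SPINE word model: THEOREM U's TOP-DOWN INJECTION AS A WORD MAP (`phiRun`)

Helper file (`--supports stmt-CriticalPhenomena-4575`), FK sub-lane `prim-bschramm-fk-2` (gen 15); builds on p205010 (kernel theorem,
internal audit signed; external expert review pending).  No named facts, no sorries, standard axioms.

Memo `bschramm/FROM-fk-2-g15-TWO-SPINE.md` §11–12 (blueprint `prim-bschramm-fk-2-g15/BLUEPRINT-U11-LEAN.md`, L2.1).  Along a spine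
(σ-word `w`, innermost letter first) with ROOT TYPE `r = (root in the γ-row?, root in the γᶜ-row?)` the nested sub-networks
`M_0 = root ⊂ M_1 ⊂ … ⊂ M_K` have two-terminal types `comps r w` (`compStep`: series = `∧`, parallel = `∨` in each row).  Theorem U's
injection (a loser configuration — `M_K` of type `01` — is sent to a winner by flipping, top-down, every `01`-part met while the
sub-network is still of type `01`) is, at the word level, the map `phiRun r w`: letter `i` is flipped `01 → 10` iff all composites
`M_i, …, M_K` are `01` (`allAbove`); the root itself is reached iff moreover `M_0 = r` is `01` (`phiReachesRoot`; in the two-spine rule of memo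
§11 this is the CRITICAL case, which happens iff the word is GROUND).  This file gives the definitions and the first facts: `phiRun`
preserves the length and only RAISES letters (`phiRun_forall₂`, the `Forall₂` flip relation of gen 14's `fiberSum_le_of_flip`).
Executable mirror: `kitjob/lp9/main.py phi_full`, `explore/rule_check.py` (the rule is machine-checked for all shape pairs `K_A+K_B ≤ 6`).
[cite: Grimmett2006, §3.8 (pp. 61–62); §3.9 (p. 63)]
-/

namespace Summit.CriticalPhenomena.PercolationContinuityZ3.Theorems

namespace FK

namespace TwoSpine

open X2Word

/-! ### Composite types along the spine -/

/-- One composition step: the type of `M ∘ R` from the type `c` of `M` and the letter of the part `R`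
(series: both rows need both to conduct; parallel: either). [folklore] -/
def compStep (c : Bool × Bool) (l : SLetter) : Bool × Bool :=
  match l.1 with
  | .W => (c.1 && l.2.1, c.2 && l.2.2)
  | .P => (c.1 || l.2.1, c.2 || l.2.2)

/-- The composite types `M_1, …, M_K` of the nested sub-networks along the spine, from the root type `r = M_0`. [folklore] -/
def comps : Bool × Bool → List SLetter → List (Bool × Bool)
  | _, [] => []
  | r, l :: w => compStep r l :: comps (compStep r l) w

/-- A two-terminal type is `01`: fails in the `γ`-row, conducts in the `γᶜ`-row (the LOSER type of Theorem U). [folklore] -/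
def is01 (c : Bool × Bool) : Bool := !c.1 && c.2

/-- For a list of composite types: at each position, `this composite and all later (outer) ones are 01`. [folklore] -/
def allAbove : List (Bool × Bool) → List Bool
  | [] => []
  | c :: cs => (is01 c && (allAbove cs).headD true) :: allAbove cs

/-- **Theorem U's top-down injection as a word map**: flip letter `i` (`01 → 10`) iff the composites `M_i, …, M_K` are all `01`. [folklore] -/
def phiRun (r : Bool × Bool) (w : List SLetter) : List SLetter :=
  List.zipWith (fun (l : SLetter) (a : Bool) => if a && (l.2 == (false, true)) then (l.1, true, false) else l) w (allAbove (comps r w))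

/-- The run reaches the ROOT (the root itself would be flipped): all composites including `M_0 = r` are `01`. [folklore] -/
def phiReachesRoot (r : Bool × Bool) (w : List SLetter) : Bool := is01 r && (allAbove (comps r w)).headD true

/-! ### First facts -/

/-- `comps` has the length of the word. [folklore] -/
@[simp] theorem comps_length (r : Bool × Bool) (w : List SLetter) : (comps r w).length = w.length := by
  induction w generalizing r with
  | nil => rfl
  | cons l w ih => simp [comps, ih]

/-- `allAbove` preserves the length. [folklore] -/
@[simp] theorem allAbove_length (cs : List (Bool × Bool)) : (allAbove cs).length = cs.length := by
  induction cs with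
  | nil => rfl
  | cons c cs ih => simp [allAbove, ih]

/-- Unfolding `phiRun` on a `cons`: the head is flipped iff the whole run is `01` from position `1` on, and the tail is the run from the
composite `M_1`. [folklore] -/
theorem phiRun_cons (r : Bool × Bool) (l : SLetter) (w : List SLetter) :
    phiRun r (l :: w) =
      (if (is01 (compStep r l) && (allAbove (comps (compStep r l) w)).headD true) && (l.2 == (false, true))
        then (l.1, true, false) else l) :: phiRun (compStep r l) w := by
  simp [phiRun, comps, allAbove]

/-- `phiRun` preserves the length. [folklore] -/
@[simp] theorem phiRun_length (r : Bool × Bool) (w : List SLetter) : (phiRun r w).length = w.length := by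
  induction w generalizing r with
  | nil => rfl
  | cons l w ih => simp [phiRun_cons, ih]

/-- **`phiRun` only raises letters**: it is related to the input by the one-sided flip relation `01 → 10` of gen 14
(`FK.fiberSum_le_of_flip`), letter by letter. [folklore] -/
theorem phiRun_forall₂ (r : Bool × Bool) (w : List SLetter) :
    List.Forall₂ (fun a b : SLetter => b = a ∨ (a.2 = (false, true) ∧ b = (a.1, true, false))) w (phiRun r w) := by
  induction w generalizing r with
  | nil => simp [phiRun]
  | cons l w ih =>
    rw [phiRun_cons]
    refine List.Forall₂.cons ?_ (ih _)
    by_cases h : ((is01 (compStep r l) && (allAbove (comps (compStep r l) w)).headD true) && (l.2 == (false, true))) = true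
    · rw [if_pos h]
      simp only [Bool.and_eq_true, beq_iff_eq] at h
      exact Or.inr ⟨h.2, rfl⟩
    · rw [if_neg h]; exact Or.inl rfl

/-- The empty word: nothing to flip; the root is reached iff the root type itself is `01`. [folklore] -/
@[simp] theorem phiRun_nil (r : Bool × Bool) : phiRun r [] = [] := rfl

/-- The root is reached on the empty word iff `r` is `01`. [folklore] -/
@[simp] theorem phiReachesRoot_nil (r : Bool × Bool) : phiReachesRoot r [] = is01 r := by
  simp [phiReachesRoot, comps, allAbove]

end TwoSpine

end FK

end Summit.CriticalPhenomena.PercolationContinuityZ3.Theorems
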